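import Mathlib
import HarnessLib
import HarnessLib.Audit
import Summits.Parity.Statement
import Literature.Barriers.Parity.SiegelZeroDichotomy
import Literature.NumberTheory.Sieve.SingularSeries

/-!
Route: AbelianShadowSplit

DORMANT since 2026-09-04T15:03:41Z (reconciler: no traction for 5 d (last activity statement-checked at 2026-08-30T13:45:12Z); parked, not closed — `ledger route dormant route-Parity-AbelianShadowSplit --off` to reactivate) — unstaffed, not closed; items shared with open routes are served there. `ledger route dormant <id> --off` reactivates.

# Route AbelianShadowSplit — GHL ⟸ Q ∧ fixed-system halves ∧ no excess / no deficit of prime pairs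
along qℕ (q ≤ N^θ) ∧ the two declared shift-uniformity residuals

decomp-parity (D-0178/D-0179) lens-2 g4 node «AbelianShadowSplit» (critic CLEARED
2026-08-30T04:47:57Z, CRITIC-LEDGER row 36), an
ALTERNATIVE DECOMPOSITION beneath the record route-Parity-SiegelSpectrumSplit at its open residual
pair UU = stmt-Parity-26853 ∧
UL = stmt-Parity-26864 (level G1.2.1; filed standalone because D-0019 allows no third layer). It
suffices to show X = Q ∧ FU ∧ FL ∧
ExcessGivenQ ∧ UU′ ∧ W⁻ ∧ UL′, where Q = BoundedSiegelZeroQuality, FU/FL = FixedUpper/FixedLower are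
the record's items VERBATIM (shared
ids 25148 / 26852 / 26863), W⁺ / W⁻ say that for every θ < 1 the prime pairs (n, n+h), n ≤ N,
AGGREGATED over the shifts h ∈ qℕ ∩ [1,N]
show no excess / no deficit εN²/q against (N−1)·Σ𝔖(qk), uniformly in q ≤ N^θ (the ABELIAN SHADOW of
GHL: its content seen by the residue
classes mod q), ExcessGivenQ = (Q → W⁺) (the excess sign is Siegel-LOADED), W⁻ is filed bare
(Siegel-INERT), and UU′ = (Q → FU → W⁺ →
UpperGHL), UL′ = (Q → FL → W⁻ → LowerGHL) are the declared residuals. Kernel (HOME file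
AbelianShadowSplit.lean, 0 sorry): every piece is
NECESSARY (new_pieces_of_ghl, hypothesis-free), the split is EXACT (uu_iff, ul_iff,
record_iff_pieces unconditional) and closes consumes all seven.
Lean: `(∃ η₀ : ℝ, ∃ q₀ : ℕ, ∀ (q : ℕ) [NeZero q] (χ : DirichletCharacter ℂ q) (η : ℝ), q₀ ≤ q →
Literature.Barriers.Parity.IsSiegelZero χ η → η < η₀) ∧ (∀ (d t : ℕ), 1 ≤ d → 1 ≤ t → ∀ Ψ : Fin t →
Literature.NumberTheory.Sieve.AffLinForm d, Literature.NumberTheory.Sieve.IsNondegenerateSystem Ψ →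
∀ ε : ℝ, 0 < ε → ∃ N₀ : ℕ, ∀ N : ℕ, N₀ ≤ N → ∀ K : Set (Fin d → ℝ), Convex ℝ K → K ⊆
Literature.NumberTheory.Sieve.realBox d N → Literature.NumberTheory.Sieve.vonMangoldtSum Ψ K N -
Literature.NumberTheory.Sieve.archFactor Ψ K * Literature.NumberTheory.Sieve.singularProduct Ψ ≤ ε *
(N : ℝ) ^ d) ∧ (∀ (d t : ℕ), 1 ≤ d → 1 ≤ t → ∀ Ψ : Fin t → Literature.NumberTheory.Sieve.AffLinForm
d, Literature.NumberTheory.Sieve.IsNondegenerateSystem Ψ → ∀ ε : ℝ, 0 < ε → ∃ N₀ : ℕ, ∀ N : ℕ, N₀ ≤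
N → ∀ K : Set (Fin d → ℝ), Convex ℝ K → K ⊆ Literature.NumberTheory.Sieve.realBox d N →
Literature.NumberTheory.Sieve.archFactor Ψ K * Literature.NumberTheory.Sieve.singularProduct Ψ -
Literature.NumberTheory.Sieve.vonMangoldtSum Ψ K N ≤ ε * (N : ℝ) ^ d) ∧ ((∃ η₀ : ℝ, ∃ q₀ : ℕ, ∀ (q :
ℕ) [NeZero q] (χ : DirichletCharacter ℂ q) (η : ℝ), q₀ ≤ q → Literature.Barriers.Parity.IsSiegelZero
χ η → η < η₀) → ∀ θ : ℝ, 0 < θ → θ < 1 → ∀ ε : ℝ, 0 < ε → ∃ N₀ : ℕ, ∀ N : ℕ, N₀ ≤ N → ∀ q : ℕ, 1 ≤ q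
→ (q : ℝ) ≤ (N : ℝ) ^ θ → (∑ k ∈ Finset.Icc 1 (N / q), ((∑ n ∈ Finset.Icc 1 N,
ArithmeticFunction.vonMangoldt n * ArithmeticFunction.vonMangoldt (n + q * k)) - ((N : ℝ) - 1) *
Literature.NumberTheory.Sieve.singularSeries ({0, ((q * k : ℕ) : ℤ)} : Finset ℤ))) ≤ ε * (N : ℝ) ^ 2
/ q) ∧ ((∃ η₀ : ℝ, ∃ q₀ : ℕ, ∀ (q : ℕ) [NeZero q] (χ : DirichletCharacter ℂ q) (η : ℝ), q₀ ≤ q →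
Literature.Barriers.Parity.IsSiegelZero χ η → η < η₀) → (∀ (d t : ℕ), 1 ≤ d → 1 ≤ t → ∀ Ψ : Fin t →
Literature.NumberTheory.Sieve.AffLinForm d, Literature.NumberTheory.Sieve.IsNondegenerateSystem Ψ →
∀ ε : ℝ, 0 < ε → ∃ N₀ : ℕ, ∀ N : ℕ, N₀ ≤ N → ∀ K : Set (Fin d → ℝ), Convex ℝ K → K ⊆
Literature.NumberTheory.Sieve.realBox d N → Literature.NumberTheory.Sieve.vonMangoldtSum Ψ K N -
Literature.NumberTheory.Sieve.archFactor Ψ K * Literature.NumberTheory.Sieve.singularProduct Ψ ≤ ε *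
(N : ℝ) ^ d) → (∀ θ : ℝ, 0 < θ → θ < 1 → ∀ ε : ℝ, 0 < ε → ∃ N₀ : ℕ, ∀ N : ℕ, N₀ ≤ N → ∀ q : ℕ, 1 ≤ q
→ (q : ℝ) ≤ (N : ℝ) ^ θ → (∑ k ∈ Finset.Icc 1 (N / q), ((∑ n ∈ Finset.Icc 1 N,
ArithmeticFunction.vonMangoldt n * ArithmeticFunction.vonMangoldt (n + q * k)) - ((N : ℝ) - 1) *
Literature.NumberTheory.Sieve.singularSeries ({0, ((q * k : ℕ) : ℤ)} : Finset ℤ))) ≤ ε * (N : ℝ) ^ 2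
/ q) → ∀ (d t L : ℕ), 1 ≤ d → 1 ≤ t → ∀ ε : ℝ, 0 < ε → ∃ N₀ : ℕ, ∀ N : ℕ, N₀ ≤ N → ∀ Ψ : Fin t →
Literature.NumberTheory.Sieve.AffLinForm d, Literature.NumberTheory.Sieve.IsNondegenerateSystem Ψ →
Literature.NumberTheory.Sieve.affLinSize Ψ N ≤ L → ∀ K : Set (Fin d → ℝ), Convex ℝ K → K ⊆
Literature.NumberTheory.Sieve.realBox d N → Literature.NumberTheory.Sieve.vonMangoldtSum Ψ K N -
Literature.NumberTheory.Sieve.archFactor Ψ K * Literature.NumberTheory.Sieve.singularProduct Ψ ≤ ε *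
(N : ℝ) ^ d) ∧ (∀ θ : ℝ, 0 < θ → θ < 1 → ∀ ε : ℝ, 0 < ε → ∃ N₀ : ℕ, ∀ N : ℕ, N₀ ≤ N → ∀ q : ℕ, 1 ≤ q
→ (q : ℝ) ≤ (N : ℝ) ^ θ → (∑ k ∈ Finset.Icc 1 (N / q), (((N : ℝ) - 1) *
Literature.NumberTheory.Sieve.singularSeries ({0, ((q * k : ℕ) : ℤ)} : Finset ℤ) - (∑ n ∈ Finset.Icc
1 N, ArithmeticFunction.vonMangoldt n * ArithmeticFunction.vonMangoldt (n + q * k)))) ≤ ε * (N : ℝ)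
^ 2 / q) ∧ ((∃ η₀ : ℝ, ∃ q₀ : ℕ, ∀ (q : ℕ) [NeZero q] (χ : DirichletCharacter ℂ q) (η : ℝ), q₀ ≤ q →
Literature.Barriers.Parity.IsSiegelZero χ η → η < η₀) → (∀ (d t : ℕ), 1 ≤ d → 1 ≤ t → ∀ Ψ : Fin t →
Literature.NumberTheory.Sieve.AffLinForm d, Literature.NumberTheory.Sieve.IsNondegenerateSystem Ψ →
∀ ε : ℝ, 0 < ε → ∃ N₀ : ℕ, ∀ N : ℕ, N₀ ≤ N → ∀ K : Set (Fin d → ℝ), Convex ℝ K → K ⊆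
Literature.NumberTheory.Sieve.realBox d N → Literature.NumberTheory.Sieve.archFactor Ψ K *
Literature.NumberTheory.Sieve.singularProduct Ψ - Literature.NumberTheory.Sieve.vonMangoldtSum Ψ K N
≤ ε * (N : ℝ) ^ d) → (∀ θ : ℝ, 0 < θ → θ < 1 → ∀ ε : ℝ, 0 < ε → ∃ N₀ : ℕ, ∀ N : ℕ, N₀ ≤ N → ∀ q : ℕ,
1 ≤ q → (q : ℝ) ≤ (N : ℝ) ^ θ → (∑ k ∈ Finset.Icc 1 (N / q), (((N : ℝ) - 1) *
Literature.NumberTheory.Sieve.singularSeries ({0, ((q * k : ℕ) : ℤ)} : Finset ℤ) - (∑ n ∈ Finset.Icc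
1 N, ArithmeticFunction.vonMangoldt n * ArithmeticFunction.vonMangoldt (n + q * k)))) ≤ ε * (N : ℝ)
^ 2 / q) → ∀ (d t L : ℕ), 1 ≤ d → 1 ≤ t → ∀ ε : ℝ, 0 < ε → ∃ N₀ : ℕ, ∀ N : ℕ, N₀ ≤ N → ∀ Ψ : Fin t →
Literature.NumberTheory.Sieve.AffLinForm d, Literature.NumberTheory.Sieve.IsNondegenerateSystem Ψ →
Literature.NumberTheory.Sieve.affLinSize Ψ N ≤ L → ∀ K : Set (Fin d → ℝ), Convex ℝ K → K ⊆
Literature.NumberTheory.Sieve.realBox d N → Literature.NumberTheory.Sieve.archFactor Ψ K *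
Literature.NumberTheory.Sieve.singularProduct Ψ - Literature.NumberTheory.Sieve.vonMangoldtSum Ψ K N
≤ ε * (N : ℝ) ^ d)`

## Assembly
Pure logic plus the elementary junction of the two one-sided halves: hUU hQ hFU (hXU hQ) is the
uniform UPPER half of GHL, hUL hQ hFL hW the
uniform LOWER half; for given (d,t,L,ε) take N₀ = max of the two thresholds and combine the two
inequalities into |Σ − β_∞∏β_p| ≤ εN^d
(abs_le). All seven binders are consumed (`closes` in glue.lean; the HOME file proves the same
through the born record's
SiegelSpectrumSplit.closes and proves exactness GHL ⟺ X mod the record's hneg for Q only, (Q ∧ UQ ∧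
LQ) ⟺ X unconditionally).

Rationale: WHY THIS LINE. The record isolates the Landau–Siegel content of GHL in Q and the fixed-system
content in FU/FL, leaving the shift-UNIFORMITY content in
the parity-blocked residual pair UU/UL. Uniformity in the constant terms has an abelian part that
multiplicative harmonic analysis owns:
summing the pair counts Σ_(n≤N) Λ(n)Λ(n+h) over h ∈ qℕ is, by orthogonality of characters mod q, the
correlation of primes with primes in
the same residue class — Goldston–Suriajaya's functional Σ_j ψ₂(·, qj) (GoldstonSuriajaya2021 §7,
sliding box here), governed by the
zeros of L(s, χ), χ mod q (Gallagher1970, Linnik1944 log-free density; individual-modulus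
Barban–Davenport–Halberstam FriedlanderGoldston1996,
HarperSoundararajan2017; exceptional zero MatomakiMerikoski2023). Cutting UU/UL by «abelian shadow
vs the rest» and by SIGN exposes (kernel)
that the excess sign is exactly where an exceptional character acts (it DOUBLES pairs along q₁ℕ,
MM2023 Thm 1.3 factor +1), so only the
upper cell needs the Q-prefix, while a deficit along qℕ would be a NEW phenomenon (a flip of the
class bias between [1,N] and (N,2N] from a
low complex zero) that no catalogued barrier produces. Versus prior routes: VarianceWitness
(18096/17130, fixed-x two-sided twisted variance,
necessity 17132 OPEN) and ClassVarianceLadder (13835, L² over q ∼ D) type the same shadow as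
stand-alone cruxes; here it is a CELL of the root
decomposition with kernel necessity from the ONE-SIDED halves at (d,t,L) = (1,2,4) (Gallagher
dictionary) and kernel exactness against the record.

RANKED CRUXES. #2 ExcessGivenQ (crux) — Q → W⁺: assuming bounded Siegel-zero quality, for every 0 <
θ < 1 and ε > 0, eventually in N, for ALL moduli 1 ≤ q ≤ N^θ: Σ_(k ≤ N/q) (X_N(qk) − (N−1)𝔖(qk)) ≤
εN²/q, X_N(h) = Σ_(n≤N) Λ(n)Λ(n+h), 𝔖(h) = singularSeries {0,h} — no EXCESS of prime pairs along qℕ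
(the upper abelian cell; WEAKER: kernel excessGivenQ_of_uu/_of_uq/_of_ghl, separating world GRH ∧ FU
∧ one moving shift of excess εN; SIEGEL-LOADED hence Q-prefixed: bare W⁺ refutes
UnboundedSiegelZeros mod MM2023, certificate = HOME-file typed support SiegelLoadingUpper (MM2023 →
W⁺(1/10) → Q, proof plan in its docstring, provable-now M, to be landed in Theorems/ as evidence —
not a route item since closes cannot consume it); KNOWN-FAMILY: VarianceWitness stmt-Parity-18096
TwistedVarianceRate / 17130 UniformTwistedVariance (fixed-x, two-sided), necessity 17132
ClassVarianceOfGHL open there, ClassVarianceLadder 13835 PrimeClassVariance (L² over q ∼ D) — the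
same abelian shadow in other dresses; LEAF IDEA-NEEDED + LADDER-INSTRUMENTABLE in the modulus level
θ: known q ≤ (log N)^A (Siegel–Walfisz / Page = PNT-in-APs class, the trivial branch), open at every
θ > 0, tolerance ladder δ(θ) ≍ e^(−c/θ) from log-free density + BDH; ZERO GHL credit, rung currency
= θ) [deps: BoundedSiegelZeroQuality] [difficulty: open-problem] (why it might fail: at q = N^θ the
o(1)-accuracy needs, for EVERY q, no zeros of any L(s,χ mod q) in 1−σ ≤ C(ε)/log q, |γ| ≤ C — beyond
Vinogradov–Korobov in the q-aspect and refutable by one family of low-lying zeros (a GRH-lite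
failure consistent with Q).) [GoldstonSuriajaya2021, MatomakiMerikoski2023, Gallagher1970,
Linnik1944, FriedlanderGoldston1996, HarperSoundararajan2017, MontgomeryVaughan2007]
#3 APShiftDeficit (crux) — W⁻ (bare): for every 0 < θ < 1 and ε > 0, eventually in N, for ALL 1 ≤ q
≤ N^θ: Σ_(k ≤ N/q) ((N−1)𝔖(qk) − X_N(qk)) ≤ εN²/q — no DEFICIT of prime pairs along qℕ (the lower
abelian cell; WEAKER: kernel apShiftDeficit_of_lowerGHL/_of_ghl/_of_lq; SIEGEL-INERT: along q₁ℕ an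
exceptional character only doubles pairs, for (q,q₁)=1 the class correlation averages to 1, so no
Q-prefix; UNDECIDED(strength vs W⁺) with stated test: a deficit is a FLIP of the class bias between
[1,N] and (N,2N] produced by one zero 1 − a/log q + iγ, γ ≈ π/log 2 — allowed by every known
theorem; Cauchy–Schwarz one-signs only the FIXED-interval aggregate; instrument: census kit A′ AP
sign table; KNOWN-FAMILY as rank 2; LEAF IDEA-NEEDED (q-aspect repulsion of low complex zeros) +
LADDER-INSTRUMENTABLE (θ), trivial branch q ≤ (log N)^A = PNT-in-APs class; ZERO GHL credit)
[difficulty: open-problem] (why it might fail: one χ mod q with a zero at 1 − a/log q + iπ/log 2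
flips the favoured classes between [1,N] and (N,2N] and gives a deficit ≍ e^(−2a/θ)·N²/q along qℕ;
nothing known excludes such zeros for growing q, so W⁻ may be GRH-lite-hard too.)
[GoldstonSuriajaya2021, Gallagher1970, Linnik1944, FriedlanderGoldston1996, HarperSoundararajan2017,
MontgomeryVaughan2007]
#4 BoundedSiegelZeroQuality (crux) — the record's Siegel crux VERBATIM (stmt-Parity-25148, shared by
signature): Siegel-zero quality is bounded at large conductors — ∃ η₀ q₀, every Siegel zero of a
primitive quadratic χ mod q ≥ q₀ has quality η < η₀ (⟺ ¬UnboundedSiegelZeros, tree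
not_unboundedSiegelZeros_iff; filing fields are the record route's). [difficulty: open-problem] (why
it might fail: it is an effective Landau–Siegel bound; only Siegel's ineffective η ≪_ε q^ε is known,
and UnboundedSiegelZeros is consistent with everything proved (Tao–Teräväinen 2021 (1.4)).)
[TaoTeravainen2021, MatomakiMerikoski2023, MontgomeryVaughan2007]
#5 UniformUpperGivenAP (crux) — DECLARED-RESIDUAL UU′ = Q → FU → W⁺ → UpperGHL: given bounded Siegel
quality, the fixed-system upper half and no excess along every qℕ, the UPPER half of GHL holds
uniformly over systems of size ≤ L (the record's UU = 26853 weakened by the extra antecedent W⁺;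
kernel uu_iff: UU ⟺ (Q → FU → W⁺) ∧ UU′; TERMINAL, zero credit; IDEA-NEEDED + BARRIER: shift-uniform
upper tuple bounds at constant 1+ε are Selberg-parity / true-complexity-binary class; T9″ forbids
population splits beneath it) [deps: BoundedSiegelZeroQuality, FixedUpper, ExcessGivenQ]
[difficulty: open-problem] (why it might fail: as a target it is summit-strength on the non-abelian
(Gowers-uniform, shift-uniform) content of GHL: no mechanism transfers fixed-system asymptotics to
moving constant terms at scale N; carried, not attacked.) [GreenTao2010, Selberg1949, Bombieri1976]
#6 UniformLowerGivenAP (crux) — DECLARED-RESIDUAL UL′ = Q → FL → W⁻ → LowerGHL: the mirror for the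
LOWER half (the record's UL = 26864 weakened by the antecedent W⁻; kernel ul_iff: UL ⟺ (Q → FL → W⁻)
∧ UL′; TERMINAL, zero credit; IDEA-NEEDED + BARRIER: shift-uniform lower bounds for prime tuples are
twin-prime class, PrimePairParity / Bombieri's asymptotic sieve) [deps: BoundedSiegelZeroQuality,
FixedLower, APShiftDeficit] [difficulty: open-problem] (why it might fail: summit-strength as a
target (uniform lower bounds for prime pairs with moving shifts contain the twin-prime-class parity
obstruction); carried, not attacked.) [GreenTao2010, Bombieri1976, Selberg1949]
#7 FixedUpper (crux) — the record's item VERBATIM (stmt-Parity-26852, shared by signature): for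
every FIXED non-degenerate system Ψ the UPPER Hardy–Littlewood inequality Σ ≤ β_∞∏β_p + εN^d holds
eventually in N, uniformly over convex K ⊆ [−N,N]^d (no uniformity in Ψ). [difficulty: open-problem]
(why it might fail: for every infinite-complexity system (any d = 1 pair) even the one-sided upper
bound at constant 1+ε is open and sieve-parity-blocked (Selberg); only constant 2^t·(1+o(1))-type
envelopes are known.) [GreenTao2010, Selberg1949, HardyLittlewood1923]
#8 FixedLower (crux) — the record's item VERBATIM (stmt-Parity-26863, shared by signature): for
every FIXED non-degenerate system the LOWER Hardy–Littlewood inequality β_∞∏β_p − Σ ≤ εN^d holds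
eventually, uniformly over convex K ⊆ [−N,N]^d. [difficulty: open-problem] (why it might fail:
contains the twin prime conjecture in Λ-asymptotic form (d = 1, t = 2, shift 2); parity-blocked for
Type-I/II methods (Bombieri's asymptotic sieve realises bias 0).) [GreenTao2010, Bombieri1976,
HardyLittlewood1923]

TWO-LAYER PLAN. Foreseen (not filed): ExcessGivenQ ⇐ (Q → W⁺ on q ≤ exp((log N)^(1/2))) → (Q → W⁺ on
exp((log N)^(1/2)) < q ≤ N^θ) → ExcessGivenQ — the
small-conductor child is Linnik–Gallagher log-free density + Siegel-under-Q territory (ATTACKABLE),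
the large-conductor child is the
GRH-lite heart; the BC3 birth skeleton cuts instead at q ≤ (log N)^10 (the Siegel–Walfisz rung,
PLAN-ONLY bc5) | q > (log N)^10.
APShiftDeficit likewise. The residuals UU′/UL′ are not split (T9″: population splits collapse; their
content is the non-abelian
shift-uniformity) — a later round may cut them by a further FUNCTIONAL (e.g. the nilpotent shadow:
aggregation over Bohr / bracket-polynomial
families of shifts), never by a population.

KILL CRITERIA. An unconditional refutation of APShiftDeficit, or of ExcessGivenQ's consequent
together with a proof of Q, refutes GHL itself (kernel
necessity new_pieces_of_ghl): route and sub-problem close refuted together. A proof of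
UnboundedSiegelZeros kills Q and with it GHL
(record convention; tree not_generalizedHardyLittlewood_of_unboundedSiegelZeros mod MM2023) — the
route closes with the record. A proof
that W⁻ FAILS under UnboundedSiegelZeros (a Siegel-produced deficit along some qℕ, contradicting the
inertness computation) does not kill
the route: it re-files rank 3 as (Q → W⁻) (pivot, exactness unchanged since Q is a sibling). A proof
elsewhere of UU (26853) or UL (26864)
moots the corresponding pair of items; a proof of W⁺ ∧ W⁻ from GRH-type hypotheses is expected and
is NOT progress on GHL (zero credit declared).

NOT DECOMPOSED YET. The level θ is NOT notched (T11(d): the filed pieces are the maximal necessary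
form ∀θ < 1; the θ-ladder lives inside the piece via
APShiftExcessAt.anti and is rung currency only). The residuals are not cut (see Two-layer plan). The
main term uses (N−1)·𝔖(qk) termwise,
not the averaged density N²/φ(q)-type main term: the Gallagher/Goldston–Suriajaya mean of 𝔖 along qℕ
is a support lemma for the rung, not
an item. No twisted (character) version is filed (that is VarianceWitness 18096's dress).

CHEAPEST FALSIFIER. (i) Degeneracy: q = 1 is the full shift average Σ_(h≤N)(X_N(h) − (N−1)𝔖(h)) =
o(N²) — true by PNT + Gallagher's mean of 𝔖 (a theorem-grade
instance, acknowledged as the trivial branch, not the content); θ = 1 would include q > N/2, a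
single shift = parity content — excluded by
θ < 1 (checked). (ii) Siegel: the critic re-derived the loading computation (row 36): exceptional
character ⇒ pure EXCESS along q₁ℕ, no
deficit — consistent with the Q-prefix on rank 2 only. (iii) BC7 #h21_crux_probe on all four new
texts: 4/4 VERDICT CLEAN (P1 not provable
cheaply, P2 hypotheses not vacuous, P5 C → S does not close). (iv) Instrument: census kit A j337514
(S_N(h)/(𝔖(h)N) ∈ [0.9944, 1.0055] over
even h ≤ 3·10^8 at N = 10^8) is consistent at every q; kit A′ (signed AP aggregates E_N(q)/(N²/q), q
≤ N^(1/2), N = 10^6..10^8) WANTED.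

NUMBERS. Known level: q ≤ (log N)^A for every A (Siegel–Walfisz; Page's theorem with one exceptional
modulus) [MontgomeryVaughan2007 Cor. 11.17–11.18,
pp. 290–291 of the held copy]. Individual-modulus BDH asymptotic V(x;q) ~ x log q known only for
x/(log x)^A ≤ q ≤ x (FriedlanderGoldston1996);
lower bound V(x;q) ≫ x log q for q ≥ x^(1/2+ε)-type ranges (HarperSoundararajan2017). MM2023 Thm
1.3: factor (1 + correction) = 2 along q₁ ∣ h.
C₂ = 0.6601…, 𝔖(m) ≥ C₂·m/φ(m) for even m ≠ 0 (tree). Census kit A j337514 as above.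

DEFINITION REQUESTS. None: all statements are over existing declarations
(ArithmeticFunction.vonMangoldt, Literature.NumberTheory.Sieve.singularSeries,
AffLinForm, IsNondegenerateSystem, affLinSize, realBox, vonMangoldtSum, archFactor, singularProduct,
Literature.Barriers.Parity.IsSiegelZero).

Novelty: Searches (2026-08-29/30): lean search
'apExcess|APShift|classVariance|residueSquareSum|TwistedVariance' (tree: VarianceWitness
18096/17130/17132, ClassVarianceLadder 13835, BDHVarianceLowerBound.classVarianceAt,
GoldstonSuriajaya residueSquareSum_eq — fixed-x dresses); lit search --hybrid "pair correlation
primes summed over shifts divisible by q" / "Barban Davenport Halberstam individual modulus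
asymptotic" (hits: montgomery2007 ch. 11, 17; Goldston–Suriajaya 2021 §7); lit galaxy search
"Hooley|Barban-Davenport-Halberstam|individual modulus" --star all (6 queries, ids in NOTES.md; no
decomposition of Hardy–Littlewood uniformity by an AP-aggregate found); the cell's 91-route census
(no route cuts UU/UL).
Nearest prior art found: GoldstonSuriajaya2021 §7 (the functional Σ_j ψ₂(N, qj) and its Siegel-zero
sensitivity, fixed x); on the hub route-Parity-VarianceWitness (18096 TwistedVarianceRate, 17132
ClassVarianceOfGHL open) and route-Parity-ClassVarianceLadder (13835); FriedlanderGoldston1996 /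
HarperSoundararajan2017 (individual-modulus BDH ranges).
Delta: the first use of the abelian (AP-aggregated) shadow as a CELL of a root decomposition of GHL
— one-sided, sliding, one modulus at every level θ < 1 — with kernel-proved necessity from the
one-sided uniform halves via the Gallagher dictionary, kernel exactness against the record's
residual leaves, and the sign asymmetry of the Landau–Siegel loading (excess loaded, deficit inert)
deciding which cell carries the Q-prefix.
Claim  [refs: GoldstonSuriajaya2021, FriedlanderGoldston1996, HarperSoundararajan2017]

Barriers (technique_class: decomposition, harmonic-analysis, primes-in-APs): - technique_class: decomposition, harmonic-analysis, primes-in-APs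
- Literature.Barriers.Parity.SiegelZeroPrimePairBarrier: ExcessGivenQ INSIDE as a bare statement (an
exceptional character doubles pairs along q₁ℕ: W⁺(1/10) ⟹ ¬UnboundedSiegelZeros mod MM2023;
HOME-file typed support SiegelLoadingUpper) — discharged by the Q-prefix exactly as the record
discharges UQ; APShiftDeficit OUTSIDE (the barrier's witnesses produce excess only; critic row 36
re-derived); residuals carry Q.
- Literature.Barriers.Parity.GoldbachAverageZeros: outside its technique class — the barrier equates
POWER SAVINGS x^(2−δ) in averaged binary counts with quasi-RH; W± ask o(1)·N²/q (no power saving)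
and are zero-free-REGION statements (width C/log q at bounded height), not half-planes; honest: the
same dictionary «aggregate accuracy ⟺ zeros» is why the leaf is IDEA-NEEDED (GRH-lite), declared.
- Literature.Barriers.Parity.BrunTitchmarshSiegelZero: consistent — W⁺ is an upper bound of
Brun–Titchmarsh type for pairs in aggregate whose bare form would kill Siegel zeros, which is
precisely why it is filed Q-prefixed (the barrier's mechanism is the loading certificate).
- Literature.Barriers.Parity.FriedlanderGranvilleUniformityBarrier: hypothesis violated — the
barrier needs moduli q > N/(log N)^B; every piece has q ≤ N^θ with θ < 1 fixed.
- Literature.Barriers.Parity.EquidistributionLimitBarrier: outside scope (Maier-matrix irregularity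
lives in intervals of length (log N)^A; the windows here have lengt

History (route lifecycle, newest last):
- 2026-09-04T15:03:41Z · DORMANT — reconciler: no traction for 5 d (last activity statement-checked at 2026-08-30T13:45:12Z); parked, not closed — `ledger route dormant route-Parity-AbelianShadow (operator:999:2000991)

sub-problem: GeneralizedHardyLittlewood · status: dormant · opened planner-decomp-parity-lens-2-g4-0 2026-08-30T05:04:32Z · rev 1 · ledger route-Parity-AbelianShadowSplit
GENERATED by the gate from the ledger (D-0016/17). Provers cite these decls: `theorem foo : Summit.Parity.GeneralizedHardyLittlewood.Theses.AbelianShadowSplit.<Decl> := …` in Summits/Parity/GeneralizedHardyLittlewood/Theorems/<Name>.lean.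
-/

namespace Summit.Parity.GeneralizedHardyLittlewood.Theses.AbelianShadowSplit

open scoped BigOperators Topology Manifold Classical MeasureTheory ProbabilityTheory Matrix InnerProductSpace ComplexConjugate ContinuousMap
open Filter Set Function TopologicalSpace MeasureTheory

attribute [summit_statement] _root_.GeneralizedHardyLittlewood

/-- item stmt-Parity-28296 · crux · rank 2 · open · by planner
why it might fail: at q = N^θ the o(1)-accuracy needs, for EVERY q, no zeros of any L(s,χ mod q) in 1−σ ≤ C(ε)/log q, |γ| ≤ C — beyond Vinogradov–Korobov in the q-aspect and refutable by one family of low-lying zeros (a GRH-lite failure consistent with Q).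
sources: GoldstonSuriajaya2021, MatomakiMerikoski2023, Gallagher1970, Linnik1944, FriedlanderGoldston1996, HarperSoundararajan2017
[crux] Q → W⁺: assuming bounded Siegel-zero quality, for every 0 < θ < 1 and ε > 0, eventually in N,
for ALL moduli 1 ≤ q ≤ N^θ: Σ_(k ≤ N/q) (X_N(qk) − (N−1)𝔖(qk)) ≤ εN²/q, X_N(h) = Σ_(n≤N) Λ(n)Λ(n+h),
𝔖(h) = singularSeries {0,h} — no EXCESS of prime pairs along qℕ (the upper abelian cell; WEAKER:
kernel excessGivenQ_of_uu/_of_uq/_of_ghl, separating world GRH ∧ FU ∧ one moving shift of excess εN;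
SIEGEL-LOADED hence Q-prefixed: bare W⁺ refutes UnboundedSiegelZeros mod MM2023, certificate =
HOME-file typed support SiegelLoadingUpper (MM2023 → W⁺(1/10) → Q, proof plan in its docstring,
provable-now M, to be landed in Theorems/ as evidence — not a route item since closes cannot consume
it); KNOWN-FAMILY: VarianceWitness stmt-Parity-18096 TwistedVarianceRate / 17130
UniformTwistedVariance (fixed-x, two-sided), necessity 17132 ClassVarianceOfGHL open there,
ClassVarianceLadder 13835 PrimeClassVariance (L² over q ∼ D) — the same abelian shadow in other
dresses; LEAF IDEA-NEEDED + LADDER-INSTRUMENTABLE in the modulus level θ: known q ≤ (log N)^A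
(Siegel–Walfisz / Page = PNT-in-APs class, the trivial branch), open at every θ > 0, tolerance
ladder δ(θ) ≍ e^(−c/θ) from log-free density + BDH -/
@[route_item "route-Parity-AbelianShadowSplit"]
def ExcessGivenQ : Prop :=
  (∃ η₀ : ℝ, ∃ q₀ : ℕ, ∀ (q : ℕ) [NeZero q] (χ : DirichletCharacter ℂ q) (η : ℝ), q₀ ≤ q → Literature.Barriers.Parity.IsSiegelZero χ η → η < η₀) → ∀ θ : ℝ, 0 < θ → θ < 1 → ∀ ε : ℝ, 0 < ε → ∃ N₀ : ℕ, ∀ N : ℕ, N₀ ≤ N → ∀ q : ℕ, 1 ≤ q → (q : ℝ) ≤ (N : ℝ) ^ θ → (∑ k ∈ Finset.Icc 1 (N / q), ((∑ n ∈ Finset.Icc 1 N, ArithmeticFunction.vonMangoldt n * ArithmeticFunction.vonMangoldt (n + q * k)) - ((N : ℝ) - 1) * Literature.NumberTheory.Sieve.singularSeries ({0, ((q * k : ℕ) : ℤ)} : Finset ℤ))) ≤ ε * (N : ℝ) ^ 2 / q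

/-- item stmt-Parity-28297 · crux · rank 3 · open · by planner
why it might fail: one χ mod q with a zero at 1 − a/log q + iπ/log 2 flips the favoured classes between [1,N] and (N,2N] and gives a deficit ≍ e^(−2a/θ)·N²/q along qℕ; nothing known excludes such zeros for growing q, so W⁻ may be GRH-lite-hard too.
sources: GoldstonSuriajaya2021, Gallagher1970, Linnik1944, FriedlanderGoldston1996, HarperSoundararajan2017, MontgomeryVaughan2007
[crux] W⁻ (bare): for every 0 < θ < 1 and ε > 0, eventually in N, for ALL 1 ≤ q ≤ N^θ: Σ_(k ≤ N/q)
((N−1)𝔖(qk) − X_N(qk)) ≤ εN²/q — no DEFICIT of prime pairs along qℕ (the lower abelian cell; WEAKER: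
kernel apShiftDeficit_of_lowerGHL/_of_ghl/_of_lq; SIEGEL-INERT: along q₁ℕ an exceptional character
only doubles pairs, for (q,q₁)=1 the class correlation averages to 1, so no Q-prefix;
UNDECIDED(strength vs W⁺) with stated test: a deficit is a FLIP of the class bias between [1,N] and
(N,2N] produced by one zero 1 − a/log q + iγ, γ ≈ π/log 2 — allowed by every known theorem;
Cauchy–Schwarz one-signs only the FIXED-interval aggregate; instrument: census kit A′ AP sign table;
KNOWN-FAMILY as rank 2; LEAF IDEA-NEEDED (q-aspect repulsion of low complex zeros) +
LADDER-INSTRUMENTABLE (θ), trivial branch q ≤ (log N)^A = PNT-in-APs class; ZERO GHL credit)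
[difficulty: open-problem] -/
@[route_item "route-Parity-AbelianShadowSplit"]
def APShiftDeficit : Prop :=
  ∀ θ : ℝ, 0 < θ → θ < 1 → ∀ ε : ℝ, 0 < ε → ∃ N₀ : ℕ, ∀ N : ℕ, N₀ ≤ N → ∀ q : ℕ, 1 ≤ q → (q : ℝ) ≤ (N : ℝ) ^ θ → (∑ k ∈ Finset.Icc 1 (N / q), (((N : ℝ) - 1) * Literature.NumberTheory.Sieve.singularSeries ({0, ((q * k : ℕ) : ℤ)} : Finset ℤ) - (∑ n ∈ Finset.Icc 1 N, ArithmeticFunction.vonMangoldt n * ArithmeticFunction.vonMangoldt (n + q * k)))) ≤ ε * (N : ℝ) ^ 2 / q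

/-- item stmt-Parity-25148 · crux · rank 4 · open · by planner
why it might fail: it is an effective Landau–Siegel bound; only Siegel's ineffective η ≪_ε q^ε is known, and UnboundedSiegelZeros is consistent with everything proved (Tao–Teräväinen 2021 (1.4)).
sources: TaoTeravainen2021, MatomakiMerikoski2023, MontgomeryVaughan2007
[crux] Siegel zeros of primitive quadratic characters have bounded quality at all large conductors:
∃ η₀ q₀, every Siegel zero (IsSiegelZero χ η) of conductor q ≥ q₀ has η < η₀ — literally
¬UnboundedSiegelZeros (Landau–Siegel in the form the MM bridge needs). [difficulty: open-problem] ‖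
TAG [crit-1 CLEARED 2026-08-30T01:46:27Z, HOME/STATUS.md l.26]: WEAKER (kernel mod MM2023 print; Q ⟹
GHL unknown); leaf IDEA-NEEDED (Landau–Siegel) + ATTACKABLE-rung (Zhang2022 skeleton routes
PrimeLevelFamEdge/ZDegreeToeplitzBand; lens-2 T_ω ladder) + INSTRUMENTABLE (finite conductor tables,
not a rung). BC3 birth skeleton: stub_weakGoldbach (WeakHLGoldbachConj ½, open) → stub_exclusion
(MM2023 Cor 1.2 Goldbach detector + |L'| ≪ log²q, provable-now) → Q. Census
HOME/census/COSTUME-CENSUS-v1.md sha256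
4afbbbc68c038369818dcc2bcc5990569ac50a4757d8938468c0838377ddd628 row WK8. -/
@[route_item "route-Parity-AbelianShadowSplit"]
def BoundedSiegelZeroQuality : Prop :=
  ∃ η₀ : ℝ, ∃ q₀ : ℕ, ∀ (q : ℕ) [NeZero q] (χ : DirichletCharacter ℂ q) (η : ℝ), q₀ ≤ q → Literature.Barriers.Parity.IsSiegelZero χ η → η < η₀

/-- item stmt-Parity-28298 · crux · rank 5 · open · by planner
why it might fail: as a target it is summit-strength on the non-abelian (Gowers-uniform, shift-uniform) content of GHL: no mechanism transfers fixed-system asymptotics to moving constant terms at scale N; carried, not attacked.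
sources: GreenTao2010, Selberg1949, Bombieri1976
[crux] DECLARED-RESIDUAL UU′ = Q → FU → W⁺ → UpperGHL: given bounded Siegel quality, the
fixed-system upper half and no excess along every qℕ, the UPPER half of GHL holds uniformly over
systems of size ≤ L (the record's UU = 26853 weakened by the extra antecedent W⁺; kernel uu_iff: UU
⟺ (Q → FU → W⁺) ∧ UU′; TERMINAL, zero credit; IDEA-NEEDED + BARRIER: shift-uniform upper tuple
bounds at constant 1+ε are Selberg-parity / true-complexity-binary class; T9″ forbids population
splits beneath it) [deps: BoundedSiegelZeroQuality, FixedUpper, ExcessGivenQ] [difficulty: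
open-problem] -/
@[route_item "route-Parity-AbelianShadowSplit"]
def UniformUpperGivenAP : Prop :=
  (∃ η₀ : ℝ, ∃ q₀ : ℕ, ∀ (q : ℕ) [NeZero q] (χ : DirichletCharacter ℂ q) (η : ℝ), q₀ ≤ q → Literature.Barriers.Parity.IsSiegelZero χ η → η < η₀) → (∀ (d t : ℕ), 1 ≤ d → 1 ≤ t → ∀ Ψ : Fin t → Literature.NumberTheory.Sieve.AffLinForm d, Literature.NumberTheory.Sieve.IsNondegenerateSystem Ψ → ∀ ε : ℝ, 0 < ε → ∃ N₀ : ℕ, ∀ N : ℕ, N₀ ≤ N → ∀ K : Set (Fin d → ℝ), Convex ℝ K → K ⊆ Literature.NumberTheory.Sieve.realBox d N → Literature.NumberTheory.Sieve.vonMangoldtSum Ψ K N - Literature.NumberTheory.Sieve.archFactor Ψ K * Literature.NumberTheory.Sieve.singularProduct Ψ ≤ ε * (N : ℝ) ^ d) → (∀ θ : ℝ, 0 < θ → θ < 1 → ∀ ε : ℝ, 0 < ε → ∃ N₀ : ℕ, ∀ N : ℕ, N₀ ≤ N → ∀ q : ℕ, 1 ≤ q → (q : ℝ) ≤ (N : ℝ)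 ^ θ → (∑ k ∈ Finset.Icc 1 (N / q), ((∑ n ∈ Finset.Icc 1 N, ArithmeticFunction.vonMangoldt n * ArithmeticFunction.vonMangoldt (n + q * k)) - ((N : ℝ) - 1) * Literature.NumberTheory.Sieve.singularSeries ({0, ((q * k : ℕ) : ℤ)} : Finset ℤ))) ≤ ε * (N : ℝ) ^ 2 / q) → ∀ (d t L : ℕ), 1 ≤ d → 1 ≤ t → ∀ ε : ℝ, 0 < ε → ∃ N₀ : ℕ, ∀ N : ℕ, N₀ ≤ N → ∀ Ψ : Fin t → Literature.NumberTheory.Sieve.AffLinForm d, Literature.NumberTheory.Sieve.IsNondegenerateSystem Ψ → Literature.NumberTheory.Sieve.affLinSize Ψ N ≤ L → ∀ K : Set (Fin d → ℝ), Convex ℝ K → K ⊆ Literature.NumberTheory.Sieve.realBox d N → Literature.NumberTheory.Sieve.vonMangoldtSum Ψ K N - Literature.NumberTheory.Sieve.archFactor Ψ K * Literature.NumberTheory.Sieve.singularProduct Ψ ≤ ε * (N : ℝ) ^ d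

/-- item stmt-Parity-28299 · crux · rank 6 · open · by planner
why it might fail: summit-strength as a target (uniform lower bounds for prime pairs with moving shifts contain the twin-prime-class parity obstruction); carried, not attacked.
sources: GreenTao2010, Bombieri1976, Selberg1949
[crux] DECLARED-RESIDUAL UL′ = Q → FL → W⁻ → LowerGHL: the mirror for the LOWER half (the record's
UL = 26864 weakened by the antecedent W⁻; kernel ul_iff: UL ⟺ (Q → FL → W⁻) ∧ UL′; TERMINAL, zero
credit; IDEA-NEEDED + BARRIER: shift-uniform lower bounds for prime tuples are twin-prime class,
PrimePairParity / Bombieri's asymptotic sieve) [deps: BoundedSiegelZeroQuality, FixedLower,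
APShiftDeficit] [difficulty: open-problem] -/
@[route_item "route-Parity-AbelianShadowSplit"]
def UniformLowerGivenAP : Prop :=
  (∃ η₀ : ℝ, ∃ q₀ : ℕ, ∀ (q : ℕ) [NeZero q] (χ : DirichletCharacter ℂ q) (η : ℝ), q₀ ≤ q → Literature.Barriers.Parity.IsSiegelZero χ η → η < η₀) → (∀ (d t : ℕ), 1 ≤ d → 1 ≤ t → ∀ Ψ : Fin t → Literature.NumberTheory.Sieve.AffLinForm d, Literature.NumberTheory.Sieve.IsNondegenerateSystem Ψ → ∀ ε : ℝ, 0 < ε → ∃ N₀ : ℕ, ∀ N : ℕ, N₀ ≤ N → ∀ K : Set (Fin d → ℝ), Convex ℝ K → K ⊆ Literature.NumberTheory.Sieve.realBox d N → Literature.NumberTheory.Sieve.archFactor Ψ K * Literature.NumberTheory.Sieve.singularProduct Ψ - Literature.NumberTheory.Sieve.vonMangoldtSum Ψ K N ≤ ε * (N : ℝ) ^ d) → (∀ θ : ℝ, 0 < θ → θ < 1 → ∀ ε : ℝ, 0 < ε → ∃ N₀ : ℕ, ∀ N : ℕ, N₀ ≤ N → ∀ q : ℕ, 1 ≤ q → (q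 : ℝ) ≤ (N : ℝ) ^ θ → (∑ k ∈ Finset.Icc 1 (N / q), (((N : ℝ) - 1) * Literature.NumberTheory.Sieve.singularSeries ({0, ((q * k : ℕ) : ℤ)} : Finset ℤ) - (∑ n ∈ Finset.Icc 1 N, ArithmeticFunction.vonMangoldt n * ArithmeticFunction.vonMangoldt (n + q * k)))) ≤ ε * (N : ℝ) ^ 2 / q) → ∀ (d t L : ℕ), 1 ≤ d → 1 ≤ t → ∀ ε : ℝ, 0 < ε → ∃ N₀ : ℕ, ∀ N : ℕ, N₀ ≤ N → ∀ Ψ : Fin t → Literature.NumberTheory.Sieve.AffLinForm d, Literature.NumberTheory.Sieve.IsNondegenerateSystem Ψ → Literature.NumberTheory.Sieve.affLinSize Ψ N ≤ L → ∀ K : Set (Fin d → ℝ), Convex ℝ K → K ⊆ Literature.NumberTheory.Sieve.realBox d N → Literature.NumberTheory.Sieve.archFactor Ψ K * Literature.NumberTheory.Sieve.singularProduct Ψ - Literature.NumberTheory.Sieve.vonMangoldtSum Ψ K N ≤ ε * (N : ℝ) ^ d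

/-- item stmt-Parity-26852 · crux · rank 7 · open · by planner
why it might fail: for every infinite-complexity system (any d = 1 pair) even the one-sided upper bound at constant 1+ε is open and sieve-parity-blocked (Selberg); only constant 2^t·(1+o(1))-type envelopes are known.
sources: GreenTao2010, Selberg1949, HardyLittlewood1923
[crux; node TupleUniformitySplit (lens-5 g3, crit-1 CLEARED 2026-08-30T03:41:11Z STATUS l.116),
quantifier-order cut of UQ: the FIXED-PATTERN upper half] For every FIXED non-degenerate
affine-linear system Ψ (all d, t; quantifier order ∀Ψ ∃N₀, no size bound) and ε > 0, eventually in N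
and uniformly in convex K ⊆ [−N,N]^d: Σ_{n∈K} ∏Λ(ψ_i(n)) − β_∞(Ψ,K)·∏β_p(Ψ) ≤ εN^d. OPEN CONTENT =
INFINITE complexity only (two affinely dependent forms: the k-tuple translates n+h_1,…,n+h_k and
their fibrations; d = 1 translate face = upper prime k-tuples in Λ-form, all k); finite-complexity
systems are the Green–Tao–Ziegler THEOREM — the AP face is not progress (critic N2). WEAKER than UQ
and than the uniform upper half (kernel: necessity fixedUpper_of_ghl; Goldbach-vacuity
fixed_holds_goldbachPair — (n, c−n) satisfies it trivially, so no binary content; Siegel-INERT: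
fixed-shift HL holds near exceptional scales, MatomakiMerikoski2023_fixedShift / Heath-Brown 1983 /
Tao–Teräväinen, while USZ refutes the uniform half) — hence typed BARE (record T1 logic). Leaf
BARRIER head-on (target constant 1; Type-I sieve ceiling 2 even under EH: SelbergParity,
LinearSieveOptimality); FU is ⊠-closed, so a constan -/
@[route_item "route-Parity-AbelianShadowSplit"]
def FixedUpper : Prop :=
  ∀ (d t : ℕ), 1 ≤ d → 1 ≤ t → ∀ Ψ : Fin t → Literature.NumberTheory.Sieve.AffLinForm d, Literature.NumberTheory.Sieve.IsNondegenerateSystem Ψ → ∀ ε : ℝ, 0 < ε → ∃ N₀ : ℕ, ∀ N : ℕ, N₀ ≤ N → ∀ K : Set (Fin d → ℝ), Convex ℝ K → K ⊆ Literature.NumberTheory.Sieve.realBox d N → Literature.NumberTheory.Sieve.vonMangoldtSum Ψ K N - Literature.NumberTheory.Sieve.archFactor Ψ K * Literature.NumberTheory.Sieve.singularProduct Ψ ≤ ε * (N : ℝ) ^ d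

/-- item stmt-Parity-26863 · crux · rank 8 · open · by planner
why it might fail: contains the twin prime conjecture in Λ-asymptotic form (d = 1, t = 2, shift 2); parity-blocked for Type-I/II methods (Bombieri's asymptotic sieve realises bias 0).
sources: GreenTao2010, Bombieri1976, HardyLittlewood1923
[crux; node TupleUniformitySplit (lens-5 g3, crit-1 CLEARED 2026-08-30T03:41:11Z STATUS l.116),
quantifier-order cut of LQ: the FIXED-PATTERN lower half] For every FIXED non-degenerate system Ψ
(all d, t; ∀Ψ ∃N₀) and ε > 0, eventually in N, uniformly in convex K ⊆ [−N,N]^d: β_∞(Ψ,K)·∏β_p(Ψ) −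
Σ_{n∈K} ∏Λ(ψ_i(n)) ≤ εN^d. OPEN CONTENT = INFINITE complexity only (k-tuple translates and their
fibrations: twin primes, prime triples, … with the Hardy–Littlewood constant); finite complexity =
Green–Tao–Ziegler theorem (critic N2). WEAKER than LQ and than the uniform lower half (kernel
fixedLower_of_ghl; fixed_holds_goldbachPair: binary Goldbach for large even N is NOT in it;
Siegel-INERT by MatomakiMerikoski2023_fixedShift / Heath-Brown 1983 / Tao–Teräväinen) — typed BARE.
Leaf IDEA-NEEDED + BARRIER head-on (PrimePairParity: no sieve-theoretic twin primes even under GEH;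
SelbergParity); FL is ⊠-closed (no constant dial on FL, T10/N1); rung currency strictly below any
single named pattern: bounded gaps H₁ ≤ 246 (Maynard / Polymath8b; tree maynardTuple chain) = some
fixed pair pattern has infinitely many prime points; TwinLowerDensity stmt-Parity-18377. -/
@[route_item "route-Parity-AbelianShadowSplit"]
def FixedLower : Prop :=
  ∀ (d t : ℕ), 1 ≤ d → 1 ≤ t → ∀ Ψ : Fin t → Literature.NumberTheory.Sieve.AffLinForm d, Literature.NumberTheory.Sieve.IsNondegenerateSystem Ψ → ∀ ε : ℝ, 0 < ε → ∃ N₀ : ℕ, ∀ N : ℕ, N₀ ≤ N → ∀ K : Set (Fin d → ℝ), Convex ℝ K → K ⊆ Literature.NumberTheory.Sieve.realBox d N → Literature.NumberTheory.Sieve.archFactor Ψ K * Literature.NumberTheory.Sieve.singularProduct Ψ - Literature.NumberTheory.Sieve.vonMangoldtSum Ψ K N ≤ ε * (N : ℝ) ^ d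

/-- item stmt-Parity-28300 · assembly · rank 1 · closed · proved by Summit.Parity.GeneralizedHardyLittlewood.Theses.AbelianShadowSplit.assembly_proof (prover) · by planner
sources: GreenTao2010
[assembly] ExcessGivenQ → APShiftDeficit → BoundedSiegelZeroQuality → UniformUpperGivenAP →
UniformLowerGivenAP → FixedUpper → FixedLower → GeneralizedHardyLittlewood -/
@[route_item "route-Parity-AbelianShadowSplit"]
def Assembly : Prop :=
  ExcessGivenQ → APShiftDeficit → BoundedSiegelZeroQuality → UniformUpperGivenAP → UniformLowerGivenAP → FixedUpper → FixedLower → GeneralizedHardyLittlewood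

-- `Assembly` holds: proved by `Summit.Parity.GeneralizedHardyLittlewood.Theses.AbelianShadowSplit.assembly_proof` (its module imports this route file, so no `_holds` link can be stated here).

/-! D-0027 §2.1 — DECIDING THEOREM (planner-authored via `route open/edit --closes-file`; by planner-decomp-parity-lens-2-g4-0 2026-08-30T05:04:32Z):
its hypotheses are this route's items and its conclusion the sub-problem Statement (glue_lint), and it elaborates with this file. -/

@[closes "route-Parity-AbelianShadowSplit"] theorem closes (hXU : ExcessGivenQ) (hW : APShiftDeficit) (hQ : BoundedSiegelZeroQuality)
    (hUU : UniformUpperGivenAP) (hUL : UniformLowerGivenAP) (hFU : FixedUpper) (hFL : FixedLower) :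
    GeneralizedHardyLittlewood := by
  have hU := hUU hQ hFU (hXU hQ)
  have hL := hUL hQ hFL hW
  intro d t L hd ht ε hε
  obtain ⟨N₁, h₁⟩ := hU d t L hd ht ε hε
  obtain ⟨N₂, h₂⟩ := hL d t L hd ht ε hε
  refine ⟨max N₁ N₂, fun N hN Ψ hΨ hLs K hK hKN => abs_le.mpr ⟨?_, ?_⟩⟩
  · have h := h₂ N (le_trans (le_max_right _ _) hN) Ψ hΨ hLs K hK hKN
    linarith
  · exact h₁ N (le_trans (le_max_left _ _) hN) Ψ hΨ hLs K hK hKN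

end Summit.Parity.GeneralizedHardyLittlewood.Theses.AbelianShadowSplit
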